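import Mathlib.NumberTheory.Real.GoldenRatio
import Mathlib.Order.Monotone.Basic
import Mathlib.Order.Interval.Set.Basic
import Mathlib.Tactic.Linarith
import Mathlib.Tactic.FieldSimp
import Mathlib.Tactic.Ring
import Mathlib.Tactic.Positivity
import HarnessLib

/-!
# One-dimensional search and interpolation methods (Antoniou–Lu 2007, Ch. 4)

Literature anchor for A. Antoniou and W.-S. Lu, *Practical Optimization: Algorithms and
Engineering Applications* (Springer, 2007) [AntoniouLu2007], Chapter 4 "One-Dimensional
Optimization": §4.1–4.2 (unimodal functions, reduction of the range of uncertainty, cases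
(a)–(c) of Fig. 4.1; dichotomous search, `I_k = (1/2)^k I_0`), §4.3 (Fibonacci search: the
interval recursion (4.2), the Fibonacci intervals (4.3)–(4.6)), §4.4 (golden-section search:
(4.19)–(4.23), `K² = K + 1`, `K = (1 + √5)/2`, `1/K = K - 1`, the golden-section sequence
`I_1/K^{n-1}`, and the comparison (4.24) `F_n ≈ K^{n+1}/√5`), §4.5 (quadratic interpolation:
(4.27)–(4.31), the minimum value of Prob. 4.10, the two-point formulas of §4.5.1) and §4.6 (cubic
interpolation: (4.33)–(4.42)).  Held copy `book:antoniou2007-practical-optimization`,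
pp. 64–74 read.

Conventions.  The book's Fibonacci numbers `F_0 = F_1 = 1, F_k = F_{k-1} + F_{k-2}` (4.4) are
`F_k = Nat.fib (k + 1)`; the golden ratio `K` of (4.23) is Mathlib's `Real.goldenRatio`.  A
function is **unimodal** on `[x_L, x_U]` with minimiser `x*` (§4.1) when it is strictly
decreasing on `[x_L, x*]` and strictly increasing on `[x*, x_U]` (`UnimodalOn`).  All
interpolation formulas are stated for the model polynomial `p` itself (the book's standing
assumption `p(x_i) = f_i`), in division-free form where a denominator may vanish.

## Main statements (all proved)

* `minimizer_lt_of_le`, `lt_minimizer_of_ge`, `minimizer_mem_Ioo_of_eq` — §4.2 cases (a)–(c):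
  the reduced range of uncertainty from two interior function values; `dichotomous_interval`;
* `fibonacci_intervals`, `fibonacci_first_interval`, `fibonacci_ratio` — (4.3), (4.5), (4.6);
* `goldenSection_ratio_sq`, `goldenSection_ratio_eq`, `inv_goldenRatio_eq_sub_one`,
  `goldenSection_intervals` — (4.19)–(4.23) and the golden-section sequence;
  `fib_mul_sqrt_five_sub_pow`, `abs_fib_sub_pow_div_sqrt_five_lt` — the comparison (4.24);
* `quadratic_vertex_isMin`, `quadratic_interp_a2`, `quadratic_interp_a1`,
  `quadratic_interp_minimizer`, `quadratic_interp_equal_spacing`, `quadratic_interp_min_value`,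
  `twoPoint_value_slope`, `twoPoint_two_slopes` — (4.27)–(4.31), Prob. 4.10, §4.5.1;
* `cubic_taylor_at_critical`, `cubic_critical_isLocalMin`, `cubic_interp_beta`,
  `cubic_interp_gamma`, `cubic_interp_coeffs` — (4.33)–(4.42).
-/

namespace Literature.Analysis.Convex.OneDimensionalSearch

open Real goldenRatio

/-! ### §4.1–4.2: unimodality and reduction of the range of uncertainty -/

/-- `f` is unimodal on `[xL, xU]` with minimiser `xs`: strictly decreasing on `[xL, xs]`,
strictly increasing on `[xs, xU]` ("f(x) has only one minimum in some range `x_L ≤ x ≤ x_U`").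
[cite: AntoniouLu2007, §4.1] -/
def UnimodalOn (f : ℝ → ℝ) (xL xU xs : ℝ) : Prop :=
  xL ≤ xs ∧ xs ≤ xU ∧ StrictAntiOn f (Set.Icc xL xs) ∧ StrictMonoOn f (Set.Icc xs xU)

variable {f : ℝ → ℝ} {xL xU xs xa xb : ℝ}

/-- **§4.2, case (a):** if `x_L ≤ x_a < x_b ≤ x_U` and `f(x_a) < f(x_b)` then `x* < x_b`
(the possibility `x_b < x* ` "would imply that `f` has two minima"); the new range is
`[x_L, x_b]`. The non-strict form `f(x_a) ≤ f(x_b)` suffices. [cite: AntoniouLu2007, §4.2 case (a), Fig. 4.1(a)] -/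
theorem minimizer_lt_of_le (hf : UnimodalOn f xL xU xs) (ha : xL ≤ xa) (hab : xa < xb)
    (hfab : f xa ≤ f xb) : xs < xb := by
  obtain ⟨_, _, hanti, _⟩ := hf
  by_contra h
  rw [not_lt] at h
  have : f xb < f xa :=
    hanti ⟨ha, by linarith⟩ ⟨by linarith, h⟩ hab
  linarith

/-- **§4.2, case (b):** if `f(x_a) > f(x_b)` (non-strictly, `≥`) then `x_a < x*`; the new range
is `[x_a, x_U]`. [cite: AntoniouLu2007, §4.2 case (b), Fig. 4.1(b)] -/
theorem lt_minimizer_of_ge (hf : UnimodalOn f xL xU xs) (hab : xa < xb) (hb : xb ≤ xU)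
    (hfab : f xb ≤ f xa) : xa < xs := by
  obtain ⟨_, _, _, hmono⟩ := hf
  by_contra h
  rw [not_lt] at h
  have : f xa < f xb :=
    hmono ⟨h, by linarith⟩ ⟨by linarith, hb⟩ hab
  linarith

/-- **§4.2, case (c):** if `f(x_a) = f(x_b)` then `x_a < x* < x_b`.
[cite: AntoniouLu2007, §4.2 case (c), Fig. 4.1(c)] -/
theorem minimizer_mem_Ioo_of_eq (hf : UnimodalOn f xL xU xs) (ha : xL ≤ xa) (hab : xa < xb)
    (hb : xb ≤ xU) (hfab : f xa = f xb) : xa < xs ∧ xs < xb :=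
  ⟨lt_minimizer_of_ge hf hab hb hfab.symm.le, minimizer_lt_of_le hf ha hab hfab.le⟩

/-- **Dichotomous search (§4.2):** halving the range at each iteration gives
`I_k = (1/2)^k I_0`. [cite: AntoniouLu2007, §4.2] -/
theorem dichotomous_interval {I : ℕ → ℝ} (hI : ∀ k, I (k + 1) = I k / 2) (k : ℕ) :
    I k = (1 / 2) ^ k * I 0 := by
  induction k with
  | zero => simp
  | succ k ih => rw [hI, ih, pow_succ]; ring

/-! ### §4.3: Fibonacci search -/

/-- **(4.3): the Fibonacci intervals.** If the intervals satisfy `I_k = I_{k+1} + I_{k+2}` (4.2)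
and `I_{n+2} = 0`, then `I_{n+1-j} = F_j I_n` for `0 ≤ j ≤ n + 1`, with the book's
`F_j = Nat.fib (j+1)` (`F_0 = F_1 = 1`). [cite: AntoniouLu2007, §4.3 (4.2)-(4.4)] -/
theorem fibonacci_intervals {I : ℕ → ℝ} {n : ℕ} (hrec : ∀ k, I k = I (k + 1) + I (k + 2))
    (hend : I (n + 2) = 0) : ∀ j ≤ n + 1, I (n + 1 - j) = Nat.fib (j + 1) * I n := by
  -- two-step induction on j
  have key : ∀ j, j ≤ n + 1 →
      I (n + 1 - j) = Nat.fib (j + 1) * I n ∧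
        (j + 1 ≤ n + 1 → I (n + 1 - (j + 1)) = Nat.fib (j + 2) * I n) := by
    intro j
    induction j with
    | zero =>
      intro _
      refine ⟨?_, fun _ => ?_⟩
      · have h := hrec n
        rw [hend, add_zero] at h
        simp [← h]
      · simp [Nat.fib_two]
    | succ j ih =>
      intro hj
      obtain ⟨h1, h2⟩ := ih (Nat.le_of_succ_le hj)
      refine ⟨h2 hj, fun hj2 => ?_⟩
      have hidx : n + 1 - (j + 1 + 1) + 1 = n + 1 - (j + 1) := by omega
      have hidx' : n + 1 - (j + 1 + 1) + 2 = n + 1 - j := by omega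
      have hf : (Nat.fib (j + 1 + 2) : ℝ) = Nat.fib (j + 1) + Nat.fib (j + 2) := by
        have : Nat.fib (j + 1 + 2) = Nat.fib (j + 1) + Nat.fib (j + 2) := Nat.fib_add_two
        rw [this, Nat.cast_add]
      rw [hrec (n + 1 - (j + 1 + 1)), hidx, hidx', h2 hj, h1, hf]
      ring
  intro j hj
  exact (key j hj).1

/-- **(4.5): `I_1 = F_n I_n`, i.e. the Fibonacci search reduces the range of uncertainty to
`I_n = I_1/F_n` after `n` iterations.** [cite: AntoniouLu2007, §4.3 (4.3b), (4.5)] -/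
theorem fibonacci_first_interval {I : ℕ → ℝ} {n : ℕ} (hrec : ∀ k, I k = I (k + 1) + I (k + 2))
    (hend : I (n + 2) = 0) : I 1 = Nat.fib (n + 1) * I n := by
  have h := fibonacci_intervals hrec hend n (Nat.le_succ n)
  rwa [show n + 1 - n = 1 by omega] at h

/-- **(4.6): the ratio of consecutive Fibonacci intervals**, `I_{k+2} F_{n-k} = F_{n-k-1} I_{k+1}`,
i.e. `I_{k+2} = (F_{n-k-1}/F_{n-k}) I_{k+1}`; stated with `m = n - k - 1`
(`I_{k+1} = I_{n-m}`, `I_{k+2} = I_{n+1-m}`, `F_{n-k} = fib (m+2)`, `F_{n-k-1} = fib (m+1)`).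
[cite: AntoniouLu2007, §4.3 (4.6)] -/
theorem fibonacci_ratio {I : ℕ → ℝ} {n : ℕ} (hrec : ∀ k, I k = I (k + 1) + I (k + 2))
    (hend : I (n + 2) = 0) {m : ℕ} (hm : m ≤ n) :
    I (n + 1 - m) * Nat.fib (m + 2) = Nat.fib (m + 1) * I (n - m) := by
  have h1 := fibonacci_intervals hrec hend (m + 1) (by omega)
  have h2 := fibonacci_intervals hrec hend m (by omega)
  rw [show n + 1 - (m + 1) = n - m by omega] at h1
  rw [h1, h2]
  ring

/-! ### §4.4: golden-section search -/

/-- **(4.19)–(4.22): a constant interval ratio satisfies `K² = K + 1`.** If `I_k = I_{k+1} + I_{k+2}`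
with `I_k = K I_{k+1}`, `I_{k+1} = K I_{k+2}` and `I_{k+2} ≠ 0`, then `K² = K + 1`.
[cite: AntoniouLu2007, §4.4 (4.19)-(4.22)] -/
theorem goldenSection_ratio_sq {I0 I1 I2 K : ℝ} (hrec : I0 = I1 + I2) (h01 : I0 = K * I1)
    (h12 : I1 = K * I2) (hI2 : I2 ≠ 0) : K ^ 2 = K + 1 := by
  have h : (K ^ 2 - (K + 1)) * I2 = 0 := by
    have : I0 = K * (K * I2) := by rw [h01, h12]
    rw [this, h12] at hrec
    linarith
  have := (mul_eq_zero.mp h).resolve_right hI2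
  linarith

/-- **(4.23): the positive root is the golden ratio**, `K = (1 + √5)/2 = 1.618034…`
("the negative value of `K` is irrelevant"). [cite: AntoniouLu2007, §4.4 (4.22)-(4.23)] -/
theorem goldenSection_ratio_eq {K : ℝ} (hK : K ^ 2 = K + 1) (hpos : 0 < K) :
    K = goldenRatio := by
  have hprod : (K - φ) * (K - ψ) = 0 := by
    have h1 : φ + ψ = 1 := goldenRatio_add_goldenConj
    have h2 : φ * ψ = -1 := goldenRatio_mul_goldenConj
    nlinarith [hK, h1, h2]
  rcases mul_eq_zero.mp hprod with h | h
  · linarith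
  · exfalso
    have : K = ψ := by linarith
    linarith [goldenConj_neg]

/-- **`1/K = K - 1 = 0.618034…`** [cite: AntoniouLu2007, §4.4 (4.22)-(4.23)] -/
theorem inv_goldenRatio_eq_sub_one : goldenRatio⁻¹ = goldenRatio - 1 := by
  rw [inv_goldenRatio]
  linarith [goldenRatio_add_goldenConj]

/-- **The golden-section sequence `{I_1, I_1/K, I_1/K², …}`:** a constant ratio `I_k = K I_{k+1}`
gives `I_{k+j} = I_k / K^j`. [cite: AntoniouLu2007, §4.4 (4.19)-(4.20)] -/
theorem goldenSection_intervals {I : ℕ → ℝ} {K : ℝ} (hK : K ≠ 0) (hI : ∀ k, I k = K * I (k + 1))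
    (k j : ℕ) : I (k + j) = I k / K ^ j := by
  induction j with
  | zero => simp
  | succ j ih =>
    have h := hI (k + j)
    rw [ih] at h
    rw [← add_assoc, pow_succ, ← div_div, h, mul_div_cancel_left₀ _ hK]

/-- **(4.24), exact form: `F_n √5 = K^{n+1} - ψ^{n+1}`** with `ψ = (1 - √5)/2` (Binet), so
`F_n ≈ K^{n+1}/√5` for large `n`. [cite: AntoniouLu2007, §4.4 (4.24)] -/
theorem fib_mul_sqrt_five_sub_pow (n : ℕ) :
    (Nat.fib (n + 1) : ℝ) * √5 = goldenRatio ^ (n + 1) - goldenConj ^ (n + 1) := by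
  rw [coe_fib_eq (n + 1), div_mul_cancel₀]
  exact Real.sqrt_ne_zero'.mpr (by norm_num)

/-- **(4.24), quantitative: `|F_n - K^{n+1}/√5| < 1/2`** (indeed `= |ψ|^{n+1}/√5 ≤ |ψ|/√5`);
e.g. `F_11 = 144`, `K^12/√5 ≈ 144.001`. [cite: AntoniouLu2007, §4.4 (4.24)] -/
theorem abs_fib_sub_pow_div_sqrt_five_lt (n : ℕ) :
    |(Nat.fib (n + 1) : ℝ) - goldenRatio ^ (n + 1) / √5| < 1 / 2 := by
  have h5 : (0 : ℝ) < √5 := Real.sqrt_pos.mpr (by norm_num)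
  have h5' : (2 : ℝ) < √5 := by
    rw [show (2 : ℝ) = √4 by rw [show (4 : ℝ) = 2 ^ 2 by norm_num, Real.sqrt_sq (by norm_num)]]
    exact Real.sqrt_lt_sqrt (by norm_num) (by norm_num)
  have hψ1 : |goldenConj| < 1 := abs_lt.mpr ⟨neg_one_lt_goldenConj, by linarith [goldenConj_neg]⟩
  have hψpow : |goldenConj ^ (n + 1)| < 1 := by
    rw [abs_pow]
    exact pow_lt_one₀ (abs_nonneg _) hψ1 (Nat.succ_ne_zero n)
  have heq : (Nat.fib (n + 1) : ℝ) - goldenRatio ^ (n + 1) / √5 = -(goldenConj ^ (n + 1)) / √5 := by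
    rw [eq_div_iff (ne_of_gt h5), sub_mul, fib_mul_sqrt_five_sub_pow, div_mul_cancel₀ _ (ne_of_gt h5)]
    ring
  rw [heq, abs_div, abs_neg, abs_of_pos h5, div_lt_iff₀ h5]
  linarith [abs_nonneg (goldenConj ^ (n + 1))]

/-! ### §4.5: quadratic interpolation -/

section Quadratic

variable {a₀ a₁ a₂ : ℝ}

/-- **(4.27): the minimiser of `p(x) = a₀ + a₁x + a₂x²` for `a₂ > 0` is `x̄ = -a₁/(2a₂)`**:
`p(x) - p(x̄) = a₂ (x - x̄)² ≥ 0`. [cite: AntoniouLu2007, §4.5 (4.25)-(4.27)] -/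
theorem quadratic_vertex_isMin (ha₂ : 0 < a₂) (x : ℝ) :
    a₀ + a₁ * (-a₁ / (2 * a₂)) + a₂ * (-a₁ / (2 * a₂)) ^ 2 ≤ a₀ + a₁ * x + a₂ * x ^ 2 := by
  have hne : a₂ ≠ 0 := ne_of_gt ha₂
  have key : a₀ + a₁ * x + a₂ * x ^ 2 - (a₀ + a₁ * (-a₁ / (2 * a₂)) + a₂ * (-a₁ / (2 * a₂)) ^ 2)
      = a₂ * (x + a₁ / (2 * a₂)) ^ 2 := by
    field_simp
    ring
  nlinarith [mul_nonneg ha₂.le (sq_nonneg (x + a₁ / (2 * a₂)))]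

variable {x₁ x₂ x₃ f₁ f₂ f₃ : ℝ}

/-- **(4.29): the leading coefficient of the interpolating parabola.** If `p(x_i) = f_i`
(`i = 1, 2, 3`) then `a₂ (x₁ - x₂)(x₁ - x₃)(x₂ - x₃) = (x₂ - x₃)f₁ + (x₃ - x₁)f₂ + (x₁ - x₂)f₃`.
[cite: AntoniouLu2007, §4.5 (4.26), (4.29)] -/
theorem quadratic_interp_a2 (h₁ : a₀ + a₁ * x₁ + a₂ * x₁ ^ 2 = f₁)
    (h₂ : a₀ + a₁ * x₂ + a₂ * x₂ ^ 2 = f₂) (h₃ : a₀ + a₁ * x₃ + a₂ * x₃ ^ 2 = f₃) :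
    a₂ * ((x₁ - x₂) * (x₁ - x₃) * (x₂ - x₃)) =
      (x₂ - x₃) * f₁ + (x₃ - x₁) * f₂ + (x₁ - x₂) * f₃ := by
  rw [← h₁, ← h₂, ← h₃]; ring

/-- **(4.28): the linear coefficient**,
`a₁ (x₁ - x₂)(x₁ - x₃)(x₂ - x₃) = -[(x₂² - x₃²)f₁ + (x₃² - x₁²)f₂ + (x₁² - x₂²)f₃]`.
[cite: AntoniouLu2007, §4.5 (4.26), (4.28)] -/
theorem quadratic_interp_a1 (h₁ : a₀ + a₁ * x₁ + a₂ * x₁ ^ 2 = f₁)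
    (h₂ : a₀ + a₁ * x₂ + a₂ * x₂ ^ 2 = f₂) (h₃ : a₀ + a₁ * x₃ + a₂ * x₃ ^ 2 = f₃) :
    a₁ * ((x₁ - x₂) * (x₁ - x₃) * (x₂ - x₃)) =
      -((x₂ ^ 2 - x₃ ^ 2) * f₁ + (x₃ ^ 2 - x₁ ^ 2) * f₂ + (x₁ ^ 2 - x₂ ^ 2) * f₃) := by
  rw [← h₁, ← h₂, ← h₃]; ring

/-- **(4.30): the three-point formula.** For distinct nodes and `a₂ ≠ 0` the vertex
`x̄ = -a₁/(2a₂)` of the interpolating parabola equals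
`[(x₂² - x₃²)f₁ + (x₃² - x₁²)f₂ + (x₁² - x₂²)f₃] / (2[(x₂ - x₃)f₁ + (x₃ - x₁)f₂ + (x₁ - x₂)f₃])`.
[cite: AntoniouLu2007, §4.5 (4.27)-(4.30)] -/
theorem quadratic_interp_minimizer (h₁ : a₀ + a₁ * x₁ + a₂ * x₁ ^ 2 = f₁)
    (h₂ : a₀ + a₁ * x₂ + a₂ * x₂ ^ 2 = f₂) (h₃ : a₀ + a₁ * x₃ + a₂ * x₃ ^ 2 = f₃)
    (h12 : x₁ ≠ x₂) (h13 : x₁ ≠ x₃) (h23 : x₂ ≠ x₃) (ha₂ : a₂ ≠ 0) :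
    -a₁ / (2 * a₂) =
      ((x₂ ^ 2 - x₃ ^ 2) * f₁ + (x₃ ^ 2 - x₁ ^ 2) * f₂ + (x₁ ^ 2 - x₂ ^ 2) * f₃) /
        (2 * ((x₂ - x₃) * f₁ + (x₃ - x₁) * f₂ + (x₁ - x₂) * f₃)) := by
  have hP : (x₁ - x₂) * (x₁ - x₃) * (x₂ - x₃) ≠ 0 :=
    mul_ne_zero (mul_ne_zero (sub_ne_zero.mpr h12) (sub_ne_zero.mpr h13)) (sub_ne_zero.mpr h23)
  have e2 := quadratic_interp_a2 h₁ h₂ h₃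
  have e1 := quadratic_interp_a1 h₁ h₂ h₃
  have hD : (x₂ - x₃) * f₁ + (x₃ - x₁) * f₂ + (x₁ - x₂) * f₃ ≠ 0 := by
    rw [← e2]; exact mul_ne_zero ha₂ hP
  have hN : (x₂ ^ 2 - x₃ ^ 2) * f₁ + (x₃ ^ 2 - x₁ ^ 2) * f₂ + (x₁ ^ 2 - x₂ ^ 2) * f₃ =
      -(a₁ * ((x₁ - x₂) * (x₁ - x₃) * (x₂ - x₃))) := by
    rw [e1, neg_neg]
  rw [div_eq_div_iff (mul_ne_zero two_ne_zero ha₂) (mul_ne_zero two_ne_zero hD), hN, ← e2]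
  ring

/-- **(4.31): equally spaced nodes** `x₁ = x₂ - δ`, `x₃ = x₂ + δ` (`δ ≠ 0`):
`x̄ = x₂ + (f₁ - f₃)δ / (2(f₁ - 2f₂ + f₃))` (Prob. 4.9). [cite: AntoniouLu2007, §4.5 (4.31), Prob. 4.9] -/
theorem quadratic_interp_equal_spacing {δ : ℝ} (h₁ : a₀ + a₁ * (x₂ - δ) + a₂ * (x₂ - δ) ^ 2 = f₁)
    (h₂ : a₀ + a₁ * x₂ + a₂ * x₂ ^ 2 = f₂) (h₃ : a₀ + a₁ * (x₂ + δ) + a₂ * (x₂ + δ) ^ 2 = f₃)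
    (hδ : δ ≠ 0) (ha₂ : a₂ ≠ 0) :
    -a₁ / (2 * a₂) = x₂ + (f₁ - f₃) * δ / (2 * (f₁ - 2 * f₂ + f₃)) := by
  have hd2 : f₁ - 2 * f₂ + f₃ = 2 * a₂ * δ ^ 2 := by rw [← h₁, ← h₂, ← h₃]; ring
  have hd1 : f₁ - f₃ = -(2 * δ) * (a₁ + 2 * a₂ * x₂) := by rw [← h₁, ← h₃]; ring
  rw [hd2, hd1]
  field_simp
  ring

/-- **Prob. 4.10: the minimum value**, `f_min = f₂ - (f₁ - f₃)²/(8(f₁ - 2f₂ + f₃))` for a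
convex quadratic through equally spaced points. [cite: AntoniouLu2007, §4.5 (4.31), Prob. 4.10] -/
theorem quadratic_interp_min_value {δ : ℝ} (h₁ : a₀ + a₁ * (x₂ - δ) + a₂ * (x₂ - δ) ^ 2 = f₁)
    (h₂ : a₀ + a₁ * x₂ + a₂ * x₂ ^ 2 = f₂) (h₃ : a₀ + a₁ * (x₂ + δ) + a₂ * (x₂ + δ) ^ 2 = f₃)
    (hδ : δ ≠ 0) (ha₂ : a₂ ≠ 0) :
    a₀ + a₁ * (-a₁ / (2 * a₂)) + a₂ * (-a₁ / (2 * a₂)) ^ 2 =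
      f₂ - (f₁ - f₃) ^ 2 / (8 * (f₁ - 2 * f₂ + f₃)) := by
  have hd2 : f₁ - 2 * f₂ + f₃ = 2 * a₂ * δ ^ 2 := by rw [← h₁, ← h₂, ← h₃]; ring
  have hd1 : f₁ - f₃ = -(2 * δ) * (a₁ + 2 * a₂ * x₂) := by rw [← h₁, ← h₃]; ring
  rw [hd2, hd1, ← h₂]
  field_simp
  ring

/-- **§4.5.1, first two-point formula** (values at `x₁, x₂`, slope `f₁'` at `x₁`):
`x̄ = x₁ + f₁'(x₂ - x₁)² / (2[f₁ - f₂ + f₁'(x₂ - x₁)])`. [cite: AntoniouLu2007, §4.5.1] -/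
theorem twoPoint_value_slope {f₁' : ℝ} (h₁ : a₀ + a₁ * x₁ + a₂ * x₁ ^ 2 = f₁)
    (h₂ : a₀ + a₁ * x₂ + a₂ * x₂ ^ 2 = f₂) (hd : a₁ + 2 * a₂ * x₁ = f₁') (h12 : x₁ ≠ x₂)
    (ha₂ : a₂ ≠ 0) :
    -a₁ / (2 * a₂) = x₁ + f₁' * (x₂ - x₁) ^ 2 / (2 * (f₁ - f₂ + f₁' * (x₂ - x₁))) := by
  have hden : f₁ - f₂ + f₁' * (x₂ - x₁) = -(a₂ * (x₂ - x₁) ^ 2) := by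
    rw [← h₁, ← h₂, ← hd]; ring
  have hx : x₂ - x₁ ≠ 0 := sub_ne_zero.mpr (Ne.symm h12)
  rw [hden, ← hd]
  field_simp
  ring

/-- **§4.5.1, second two-point formula** (slopes `f₁', f₂'` at `x₁ ≠ x₂`):
`x̄ = (x₂f₁' - x₁f₂')/(f₁' - f₂') = x₂ + (x₂ - x₁)f₂'/(f₁' - f₂')`. [cite: AntoniouLu2007, §4.5.1] -/
theorem twoPoint_two_slopes {f₁' f₂' : ℝ} (hd₁ : a₁ + 2 * a₂ * x₁ = f₁')
    (hd₂ : a₁ + 2 * a₂ * x₂ = f₂') (h12 : x₁ ≠ x₂) (ha₂ : a₂ ≠ 0) :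
    -a₁ / (2 * a₂) = (x₂ * f₁' - x₁ * f₂') / (f₁' - f₂') ∧
      (x₂ * f₁' - x₁ * f₂') / (f₁' - f₂') = x₂ + (x₂ - x₁) * f₂' / (f₁' - f₂') := by
  have hden : f₁' - f₂' = 2 * a₂ * (x₁ - x₂) := by rw [← hd₁, ← hd₂]; ring
  have hne : f₁' - f₂' ≠ 0 := by
    rw [hden]; exact mul_ne_zero (mul_ne_zero two_ne_zero ha₂) (sub_ne_zero.mpr h12)
  constructor
  · rw [eq_div_iff hne, ← hd₁, ← hd₂]
    field_simp
    ring
  · field_simp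
    ring

end Quadratic

/-! ### §4.6: cubic interpolation -/

section Cubic

variable {a₀ a₁ a₂ a₃ : ℝ}

/-- **(4.33)–(4.35): Taylor form of a cubic at a critical point.** If
`p'(x̄) = a₁ + 2a₂x̄ + 3a₃x̄² = 0` then `p(x) - p(x̄) = (x - x̄)² [(a₂ + 3a₃x̄) + a₃(x - x̄)]`,
where `2(a₂ + 3a₃x̄) = p''(x̄)`; so the extremum with `p''(x̄) > 0` (4.35) is the local
minimiser. [cite: AntoniouLu2007, §4.6 (4.32)-(4.35)] -/
theorem cubic_taylor_at_critical {xb : ℝ} (hcrit : a₁ + 2 * a₂ * xb + 3 * a₃ * xb ^ 2 = 0)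
    (x : ℝ) :
    (a₀ + a₁ * x + a₂ * x ^ 2 + a₃ * x ^ 3) - (a₀ + a₁ * xb + a₂ * xb ^ 2 + a₃ * xb ^ 3) =
      (x - xb) ^ 2 * ((a₂ + 3 * a₃ * xb) + a₃ * (x - xb)) := by
  have : a₁ = -(2 * a₂ * xb + 3 * a₃ * xb ^ 2) := by linarith
  subst this
  ring

/-- **(4.35): the critical point with `p''(x̄) = 2a₂ + 6a₃x̄ > 0` is a local minimiser**: `p(x̄) ≤ p(x)`
whenever `|a₃| |x - x̄| ≤ a₂ + 3a₃x̄`. [cite: AntoniouLu2007, §4.6 (4.33)-(4.35)] -/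
theorem cubic_critical_isLocalMin {xb : ℝ} (hcrit : a₁ + 2 * a₂ * xb + 3 * a₃ * xb ^ 2 = 0)
    {x : ℝ} (hx : |a₃| * |x - xb| ≤ a₂ + 3 * a₃ * xb) :
    a₀ + a₁ * xb + a₂ * xb ^ 2 + a₃ * xb ^ 3 ≤ a₀ + a₁ * x + a₂ * x ^ 2 + a₃ * x ^ 3 := by
  have h := cubic_taylor_at_critical (a₀ := a₀) hcrit x
  have hfac : 0 ≤ (a₂ + 3 * a₃ * xb) + a₃ * (x - xb) := by
    have : -(|a₃| * |x - xb|) ≤ a₃ * (x - xb) := by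
      rw [← abs_mul]; exact neg_abs_le _
    linarith
  nlinarith [mul_nonneg (sq_nonneg (x - xb)) hfac]

variable {x₁ x₂ x₃ f₁ f₂ f₃ f₁' : ℝ}

/-- **(4.39), (4.41), (4.37): `β = a₂ + θ a₃` with `θ = 2x₁ + x₂`** — for the cubic through
`(x₁, f₁), (x₂, f₂)` with slope `f₁'` at `x₁`:
`f₂ - f₁ + f₁'(x₁ - x₂) = (a₂ + (2x₁ + x₂)a₃)(x₁ - x₂)²` and
`2x₁² - x₂(x₁ + x₂) = (2x₁ + x₂)(x₁ - x₂)`. [cite: AntoniouLu2007, §4.6 (4.37), (4.39), (4.41)] -/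
theorem cubic_interp_beta (h₁ : a₀ + a₁ * x₁ + a₂ * x₁ ^ 2 + a₃ * x₁ ^ 3 = f₁)
    (h₂ : a₀ + a₁ * x₂ + a₂ * x₂ ^ 2 + a₃ * x₂ ^ 3 = f₂)
    (hd : a₁ + 2 * a₂ * x₁ + 3 * a₃ * x₁ ^ 2 = f₁') :
    f₂ - f₁ + f₁' * (x₁ - x₂) = (a₂ + (2 * x₁ + x₂) * a₃) * (x₁ - x₂) ^ 2 ∧
      2 * x₁ ^ 2 - x₂ * (x₁ + x₂) = (2 * x₁ + x₂) * (x₁ - x₂) := by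
  constructor
  · rw [← h₁, ← h₂, ← hd]; ring
  · ring

/-- **(4.40), (4.42): `γ = a₂ + ψ a₃` with `ψ = 2x₁ + x₃`.** [cite: AntoniouLu2007, §4.6 (4.40), (4.42)] -/
theorem cubic_interp_gamma (h₁ : a₀ + a₁ * x₁ + a₂ * x₁ ^ 2 + a₃ * x₁ ^ 3 = f₁)
    (h₃ : a₀ + a₁ * x₃ + a₂ * x₃ ^ 2 + a₃ * x₃ ^ 3 = f₃)
    (hd : a₁ + 2 * a₂ * x₁ + 3 * a₃ * x₁ ^ 2 = f₁') :
    f₃ - f₁ + f₁' * (x₁ - x₃) = (a₂ + (2 * x₁ + x₃) * a₃) * (x₁ - x₃) ^ 2 := by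
  rw [← h₁, ← h₃, ← hd]; ring

/-- **(4.36)–(4.38): recovery of the coefficients.** With `β, γ, θ, ψ` as in (4.39)–(4.42)
(`x₁, x₂, x₃` distinct): `a₃ = (β - γ)/(θ - ψ)`, `a₂ = β - θ a₃`, `a₁ = f₁' - 2a₂x₁ - 3a₃x₁²`.
[cite: AntoniouLu2007, §4.6 (4.36)-(4.42)] -/
theorem cubic_interp_coeffs (h₁ : a₀ + a₁ * x₁ + a₂ * x₁ ^ 2 + a₃ * x₁ ^ 3 = f₁)
    (h₂ : a₀ + a₁ * x₂ + a₂ * x₂ ^ 2 + a₃ * x₂ ^ 3 = f₂)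
    (h₃ : a₀ + a₁ * x₃ + a₂ * x₃ ^ 2 + a₃ * x₃ ^ 3 = f₃)
    (hd : a₁ + 2 * a₂ * x₁ + 3 * a₃ * x₁ ^ 2 = f₁') (h12 : x₁ ≠ x₂) (h13 : x₁ ≠ x₃)
    (h23 : x₂ ≠ x₃) :
    let β := (f₂ - f₁ + f₁' * (x₁ - x₂)) / (x₁ - x₂) ^ 2
    let γ := (f₃ - f₁ + f₁' * (x₁ - x₃)) / (x₁ - x₃) ^ 2
    let θ := (2 * x₁ ^ 2 - x₂ * (x₁ + x₂)) / (x₁ - x₂)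
    let ψ' := (2 * x₁ ^ 2 - x₃ * (x₁ + x₃)) / (x₁ - x₃)
    a₃ = (β - γ) / (θ - ψ') ∧ a₂ = β - θ * a₃ ∧ a₁ = f₁' - 2 * a₂ * x₁ - 3 * a₃ * x₁ ^ 2 := by
  have hx12 : x₁ - x₂ ≠ 0 := sub_ne_zero.mpr h12
  have hx13 : x₁ - x₃ ≠ 0 := sub_ne_zero.mpr h13
  have hβ : (f₂ - f₁ + f₁' * (x₁ - x₂)) / (x₁ - x₂) ^ 2 = a₂ + (2 * x₁ + x₂) * a₃ := by
    rw [(cubic_interp_beta h₁ h₂ hd).1, mul_div_assoc, div_self (pow_ne_zero 2 hx12), mul_one]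
  have hγ : (f₃ - f₁ + f₁' * (x₁ - x₃)) / (x₁ - x₃) ^ 2 = a₂ + (2 * x₁ + x₃) * a₃ := by
    rw [cubic_interp_gamma h₁ h₃ hd, mul_div_assoc, div_self (pow_ne_zero 2 hx13), mul_one]
  have hθ : (2 * x₁ ^ 2 - x₂ * (x₁ + x₂)) / (x₁ - x₂) = 2 * x₁ + x₂ := by
    rw [div_eq_iff hx12]; ring
  have hψ : (2 * x₁ ^ 2 - x₃ * (x₁ + x₃)) / (x₁ - x₃) = 2 * x₁ + x₃ := by
    rw [div_eq_iff hx13]; ring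
  simp only
  rw [hβ, hγ, hθ, hψ]
  refine ⟨?_, by ring, by rw [← hd]; ring⟩
  have hx23 : (2 * x₁ + x₂) - (2 * x₁ + x₃) ≠ 0 := by
    rw [show (2 * x₁ + x₂) - (2 * x₁ + x₃) = x₂ - x₃ by ring]; exact sub_ne_zero.mpr h23
  rw [eq_div_iff hx23]
  ring

end Cubic

end Literature.Analysis.Convex.OneDimensionalSearch
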